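import Mathlib
import Summits.NavierStokesRegularity.NavierStokesRegularity.Theorems.EulerZoomLiouvillePowerGaugeEulerLiouvilleSelfSimilarEndpointLiouville
import Summits.NavierStokesRegularity.NavierStokesRegularity.Theorems.EulerZoomLiouvillePowerGaugeEulerLiouvilleSelfSimilarLEI
import Summits.NavierStokesRegularity.NavierStokesRegularity.Theorems.EulerZoomLiouvillePowerGaugeEulerLiouvilleSelfSimilarGauges
import Summits.NavierStokesRegularity.NavierStokesRegularity.Theorems.EulerZoomLiouvillePowerGaugeEulerLiouvilleSelfSimilarPressure
import Summits.NavierStokesRegularity.NavierStokesRegularity.Theorems.EulerZoomLiouvillePowerGaugeEulerLiouvilleWindowFluxTools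
import Summits.NavierStokesRegularity.NavierStokesRegularity.Theorems.EulerZoomLiouvillePowerGaugeEulerLiouvilleSelfSimilarEndpointProfileCube
import HarnessLib

/-!
# Rung C1 of the crux `EulerZoomLiouville.PowerGaugeEulerLiouville` at the endpoint `ρ = 1/2`:
# the power-spread stratum of exactly self-similar members (Chae–Shvydkoy Thm 3.1 in E's class)

Route №10 `EulerZoomLiouville` (NavierStokesRegularity), crux E = stmt-NavierStokesRegularity-19832,
tenure rung C1 (`Cruxes/PowerGaugeEulerLiouville/Lines/rungC_window.lean`, `Sig.rungC1_selfSimilar`)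
at the energy-conserving endpoint `ρ = 1/2` (`γ = 1/(2+ρ) = 2/5`, Chae–Shvydkoy `α = N/2`).
MEMBER-LEVEL form of the profile theorems of `…SelfSimilarEndpointLiouville`: an exactly
self-similar member `u(τ) = selfSimilarCollapse γ 0 V τ`, `p(τ) = selfSimilarCollapsePressure γ 0 P τ`
of Seregin's power-gauged ancient Euler class at `ρ = 1/2` (the three hypotheses of the crux)
whose profile

* has the Riesz pressure: `P = Π[V·1_{B_R}] + ∫_{|z| ≥ R} K(·−z)(V z) dz` a.e. on `|y| < R/2` for
  all large `R` (CS13's standing assumption "the pressure given by (2.3)"),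
* has the POWER SPREAD `c|y|^{−(4−δ')} ≤ ‖V(y)‖ ≤ C_up|y|^{1−δ}` a.e. far out,

does not exist (`selfSimilar_half_false_of_powerSpread`); equivalently every such member vanishes
(`selfSimilar_half_ae_eq_zero_of_powerSpread`, the shape of `Sig.rungC1_selfSimilar` restricted
to this stratum).  From the class we use: `V ∈ L²` (`A`-gauge at the endpoint), the weighted
pressure bound of the `D`-gauge (`∫ |P|^{3/2}|y|^{−1} ≤ 2c/5`, giving `|P||V| ∈ L¹_loc`) and the
forward profile local energy inequality; and `V ∈ L³_loc` (`…SelfSimilarEndpointProfileCube`,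
from `u ∈ L^{10/3}_loc`), the weak replacement of Chae–Shvydkoy's `C¹_loc`.

WHAT THIS IS NOT: not NS, not E, not rung C1 — one printed stratum of C1 at the endpoint,
transported into the suitable weak class; the endpoint WITHOUT a lower power bound stays open.
-/

noncomputable section

-- flat `Theorems/<Route><Decl>…` files of one crux share the namespace of the crux (tree convention)
set_option linter.dupNamespace false

open MeasureTheory Set Filter Topology Metric Function
open scoped ENNReal NNReal InnerProductSpace RealInnerProductSpace

namespace Summit.NavierStokesRegularity.NavierStokesRegularity.Theorems.PowerGaugeEulerLiouville

open Literature.Analysis Literature.Analysis.FunctionSpaces Literature.Analysis.FluidPDE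

section Helpers

variable {V : EuclideanSpace ℝ (Fin 3) → EuclideanSpace ℝ (Fin 3)} {P : EuclideanSpace ℝ (Fin 3) → ℝ}

/-- `‖V‖² ∈ L¹` from `∫⁻ ‖V‖ₑ² < ∞`. [folklore] -/
theorem integrable_norm_sq_of_lintegral_lt_top (hVm : AEStronglyMeasurable V volume)
    (h : ∫⁻ y, ‖V y‖ₑ ^ 2 < ⊤) : Integrable (fun y => ‖V y‖ ^ 2) volume := by
  refine ⟨(hVm.norm.pow 2), ?_⟩
  rw [hasFiniteIntegral_iff_enorm]
  refine lt_of_le_of_lt (le_of_eq (lintegral_congr fun y => ?_)) h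
  show ‖‖V y‖ ^ 2‖ₑ = ‖V y‖ₑ ^ 2
  rw [Real.enorm_eq_ofReal (sq_nonneg _), ENNReal.ofReal_pow (norm_nonneg _), ofReal_norm]

/-- **`|P||V| ∈ L¹_loc` at the endpoint** from the weighted pressure bound of the `D`-gauge
(`∫ |P|^{3/2} |y|^{−1} < ∞`) and `V ∈ L³_loc` (Hölder `(3/2, 3)` on balls). [folklore] -/
theorem locallyIntegrable_abs_mul_norm_of_weight (hPm : AEStronglyMeasurable P volume)
    (hVm : AEStronglyMeasurable V volume) (hV3 : LocallyIntegrable (fun y => ‖V y‖ ^ 3) volume)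
    {B : ℝ≥0∞} (hB : B ≠ ⊤)
    (hPw : ∫⁻ y, ‖P y‖ₑ ^ (3 / 2 : ℝ) * ENNReal.ofReal (‖y‖ ^ (2 * (1 / 2 : ℝ) - 2)) ≤ B) :
    LocallyIntegrable (fun y => |P y| * ‖V y‖) volume := by
  rw [locallyIntegrable_iff]
  intro K hK
  obtain ⟨R, hKR⟩ := hK.isBounded.subset_closedBall (0 : EuclideanSpace ℝ (Fin 3))
  set R' : ℝ := max R 1 with hR'
  have hR'0 : 0 < R' := lt_max_of_lt_right one_pos
  have hKR' : K ⊆ closedBall (0 : EuclideanSpace ℝ (Fin 3)) R' :=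
    hKR.trans (closedBall_subset_closedBall (le_max_left _ _))
  refine IntegrableOn.mono_set ?_ hKR'
  set D : Set (EuclideanSpace ℝ (Fin 3)) := closedBall 0 R' with hD
  have hmeas : AEStronglyMeasurable (fun y => |P y| * ‖V y‖) (volume.restrict D) :=
    (hPm.norm.mul hVm.norm).restrict.congr (Eventually.of_forall fun y => by
      simp [Real.norm_eq_abs])
  refine ⟨hmeas, ?_⟩
  rw [hasFiniteIntegral_iff_enorm]
  -- `‖ |P||V| ‖ₑ = ‖P‖ₑ ‖V‖ₑ`
  have hpt : ∀ y, ‖|P y| * ‖V y‖‖ₑ = ‖P y‖ₑ * ‖V y‖ₑ := fun y => by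
    rw [enorm_mul, ← Real.norm_eq_abs, enorm_norm, enorm_norm]
  simp_rw [hpt]
  -- Hölder `(3/2, 3)` on `D`
  refine lt_of_le_of_lt (WindowFlux.lintegral_mul_le_threeHalves_three _
    hPm.restrict.enorm hVm.restrict.enorm) ?_
  refine ENNReal.mul_lt_top (ENNReal.rpow_lt_top_of_nonneg (by norm_num) ?_)
    (ENNReal.rpow_lt_top_of_nonneg (by norm_num) ?_)
  · -- `∫_D ‖P‖ₑ^{3/2} ≤ R' · B`
    refine ne_of_lt (lt_of_le_of_lt (b := ENNReal.ofReal R' * B) ?_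
      (ENNReal.mul_lt_top ENNReal.ofReal_lt_top hB.lt_top))
    have h0 : ∀ᵐ y ∂(volume.restrict D), y ≠ (0 : EuclideanSpace ℝ (Fin 3)) := by
      refine ae_restrict_of_ae ?_
      rw [ae_iff]
      simp only [ne_eq, not_not, setOf_eq_eq_singleton, measure_singleton]
    calc ∫⁻ y in D, ‖P y‖ₑ ^ (3 / 2 : ℝ)
        ≤ ∫⁻ y in D, ENNReal.ofReal R' *
            (‖P y‖ₑ ^ (3 / 2 : ℝ) * ENNReal.ofReal (‖y‖ ^ (2 * (1 / 2 : ℝ) - 2))) := by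
          refine lintegral_mono_ae ?_
          filter_upwards [h0, ae_restrict_mem measurableSet_closedBall] with y hy0 hyD
          rw [mem_closedBall, dist_zero_right] at hyD
          have hy : 0 < ‖y‖ := norm_pos_iff.2 hy0
          have hw : (1 : ℝ≥0∞) ≤ ENNReal.ofReal R' * ENNReal.ofReal (‖y‖ ^ (2 * (1 / 2 : ℝ) - 2)) := by
            rw [← ENNReal.ofReal_mul hR'0.le, ← ENNReal.ofReal_one]
            refine ENNReal.ofReal_le_ofReal ?_
            norm_num
            rw [Real.rpow_neg_one, ← div_eq_mul_inv, le_div_iff₀ hy, one_mul]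
            exact hyD
          calc ‖P y‖ₑ ^ (3 / 2 : ℝ) = ‖P y‖ₑ ^ (3 / 2 : ℝ) * 1 := (mul_one _).symm
            _ ≤ ‖P y‖ₑ ^ (3 / 2 : ℝ) *
                (ENNReal.ofReal R' * ENNReal.ofReal (‖y‖ ^ (2 * (1 / 2 : ℝ) - 2))) := by gcongr
            _ = ENNReal.ofReal R' *
                (‖P y‖ₑ ^ (3 / 2 : ℝ) * ENNReal.ofReal (‖y‖ ^ (2 * (1 / 2 : ℝ) - 2))) := by ring
      _ = ENNReal.ofReal R' *
            ∫⁻ y in D, ‖P y‖ₑ ^ (3 / 2 : ℝ) * ENNReal.ofReal (‖y‖ ^ (2 * (1 / 2 : ℝ) - 2)) := by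
          rw [lintegral_const_mul' _ _ ENNReal.ofReal_ne_top]
      _ ≤ ENNReal.ofReal R' * B := by
          gcongr
          exact (setLIntegral_le_lintegral _ _).trans hPw
  · -- `∫_D ‖V‖ₑ^3 < ∞`
    have h3 := (hV3.integrableOn_isCompact (isCompact_closedBall (0 : EuclideanSpace ℝ (Fin 3)) R')).2
    rw [hasFiniteIntegral_iff_enorm] at h3
    refine ne_of_lt (lt_of_le_of_lt (le_of_eq (lintegral_congr fun y => ?_)) h3)
    show ‖V y‖ₑ ^ (3 : ℝ) = ‖‖V y‖ ^ 3‖ₑ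
    rw [Real.enorm_eq_ofReal (by positivity), ENNReal.ofReal_pow (norm_nonneg _),
      ofReal_norm, ← ENNReal.rpow_natCast]
    norm_num

end Helpers

section Member

/-- **No energy-conserving self-similar Euler collapse with a power spread, in E's class.**
Let `(u, p, H, c)` satisfy the three hypotheses of the crux `PowerGaugeEulerLiouville` at
`ρ = 1/2` (suitable weak ancient Euler pair on `ℝ³ × (−∞,0)`, weak spatial gradient `H`, gauge
`a·A(a) + a^{1/2}·E(a) + a·D(a) ≤ c`) and be EXACTLY SELF-SIMILAR with the class exponents
(`γ = 1/(2+1/2) = 2/5`): `u(τ) = selfSimilarCollapse γ 0 V τ`, `p(τ) = selfSimilarCollapsePressure γ 0 P τ`.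
If the pressure profile is the Riesz pressure of `V` at large scales and `V` has the power spread `c₀|y|^{−(4−δ')} ≤ ‖V(y)‖ ≤ C_up|y|^{1−δ}` a.e. for large
`|y|` (`c₀, δ, δ' > 0`, `δ ≤ 1`), we reach a contradiction.  This is Chae–Shvydkoy's Thm 3.1
(energy-conserving scaling, `v ∈ L² ∩ C¹_loc` with power spread ⇒ `v = 0`) inside Seregin's
suitable weak class, where `V ∈ L²` is automatic (`A`-gauge) and the local energy inequality
replaces `C¹_loc`. [cite: ChaeShvydkoy2013, §3.1 Thm. 3.1] -/
theorem selfSimilar_half_false_of_powerSpread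
    {u : ℝ → EuclideanSpace ℝ (Fin 3) → EuclideanSpace ℝ (Fin 3)}
    {p : ℝ → EuclideanSpace ℝ (Fin 3) → ℝ}
    {H : ℝ → EuclideanSpace ℝ (Fin 3) → EuclideanSpace ℝ (Fin 3) →L[ℝ] EuclideanSpace ℝ (Fin 3)}
    {c : ℝ≥0} {V : EuclideanSpace ℝ (Fin 3) → EuclideanSpace ℝ (Fin 3)}
    {P : EuclideanSpace ℝ (Fin 3) → ℝ}
    (hsw : IsSuitableWeakSolutionOn (slab (EuclideanSpace ℝ (Fin 3)) (Iio 0) isOpen_Iio) 0 0 u p)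
    (hH : HasWeakSpatialGradientOn (slab (EuclideanSpace ℝ (Fin 3)) (Iio 0) isOpen_Iio) u H)
    (hgauge : ∀ a : ℝ, 0 < a →
      ENNReal.ofReal (a ^ (2 * (1 / 2 : ℝ))) * cknA a (0 : ℝ × EuclideanSpace ℝ (Fin 3)) u +
          ENNReal.ofReal (a ^ (1 / 2 : ℝ)) * cknE a (0 : ℝ × EuclideanSpace ℝ (Fin 3)) H +
        ENNReal.ofReal (a ^ (2 * (1 / 2 : ℝ))) * cknD a (0 : ℝ × EuclideanSpace ℝ (Fin 3)) p ≤
          (c : ℝ≥0∞))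
    (hu : ∀ τ : ℝ, τ < 0 → u τ = selfSimilarCollapse (1 / (2 + (1 / 2 : ℝ))) 0 V τ)
    (hp : ∀ τ : ℝ, τ < 0 → p τ = selfSimilarCollapsePressure (1 / (2 + (1 / 2 : ℝ))) 0 P τ)
    {R₁ : ℝ}
    (hPR : ∀ R : ℝ, R₁ ≤ R → ∀ᵐ y ∂volume, ‖y‖ < R / 2 →
      P y = rieszPressure ((ball (0 : EuclideanSpace ℝ (Fin 3)) R).indicator V) y +
        ∫ z in {z | R ≤ ‖z‖}, pressureKernel (y - z) (V z))
    {δ Cup R₀ : ℝ} (hδ : 0 < δ) (hδ1 : δ ≤ 1) (hCup : 0 ≤ Cup)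
    (hup : ∀ᵐ y ∂volume, R₀ ≤ ‖y‖ → ‖V y‖ ≤ Cup * ‖y‖ ^ (1 - δ))
    {c₀ δ' R₀' : ℝ} (hc₀ : 0 < c₀) (hδ' : 0 < δ')
    (hlow : ∀ᵐ y ∂volume, R₀' ≤ ‖y‖ → c₀ * ‖y‖ ^ (-(4 - δ')) ≤ ‖V y‖) : False := by
  -- the gauges separately
  have hA : ∀ a : ℝ, 0 < a → ENNReal.ofReal (a ^ (2 * (1 / 2 : ℝ))) *
      cknA a (0 : ℝ × EuclideanSpace ℝ (Fin 3)) u ≤ (c : ℝ≥0∞) :=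
    fun a ha => le_trans (le_trans le_self_add le_self_add) (hgauge a ha)
  have hD : ∀ a : ℝ, 0 < a → ENNReal.ofReal (a ^ (2 * (1 / 2 : ℝ))) *
      cknD a (0 : ℝ × EuclideanSpace ℝ (Fin 3)) p ≤ (c : ℝ≥0∞) :=
    fun a ha => le_trans le_add_self (hgauge a ha)
  -- measurability of `u`, `p` on the slab and of the profiles
  have hum : AEStronglyMeasurable (uncurry u)
      (volume.restrict (Iio (0 : ℝ) ×ˢ (univ : Set (EuclideanSpace ℝ (Fin 3))))) := by
    have := hH.locallyIntegrableOn.aestronglyMeasurable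
    simpa [slab] using this
  have hpm : AEStronglyMeasurable (uncurry p)
      (volume.restrict (Iio (0 : ℝ) ×ˢ (univ : Set (EuclideanSpace ℝ (Fin 3))))) := by
    have := hsw.distributional.2.2.1.aestronglyMeasurable
    simpa [slab] using this
  have hVm := aestronglyMeasurable_profile hum hu
  have hPm := aestronglyMeasurable_pressureProfile hpm hp
  -- `V ∈ L³_loc` (slice of `|u|³ ∈ L¹_loc`)
  have hV3 : LocallyIntegrable (fun y => ‖V y‖ ^ 3) volume := locallyIntegrable_cube_profile hsw hum hu
  -- `V ∈ L²` (endpoint `A`-gauge)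
  have hV2l := lintegral_enorm_sq_profile_le_of_half hu hA
  have hV2 : Integrable (fun y => ‖V y‖ ^ 2) volume :=
    integrable_norm_sq_of_lintegral_lt_top hVm (lt_of_le_of_lt hV2l ENNReal.coe_lt_top)
  -- `|P||V| ∈ L¹_loc` (weighted `D`-gauge bound + `V ∈ L³_loc`)
  have hPw := profile_pressure_weight_of_gaugeD (ρ := 1 / 2) (by norm_num) (by norm_num) hpm hp hD
  have hPV : LocallyIntegrable (fun y => |P y| * ‖V y‖) volume :=
    locallyIntegrable_abs_mul_norm_of_weight hPm hVm hV3
      (ENNReal.mul_ne_top ENNReal.ofReal_ne_top ENNReal.coe_ne_top) hPw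
  -- the forward profile LEI of the class
  have hLEI := fun (σ : EuclideanSpace ℝ (Fin 3) → ℝ) (hσ : ContDiff ℝ (⊤ : ℕ∞) σ)
      (hσc : HasCompactSupport σ) (hσ0 : ∀ x, 0 ≤ σ x) =>
    selfSimilar_profile_energy_le_add_flux hsw hu hp hσ hσc hσ0
  exact profile_liouville_half_of_powerSpread hVm hV2 hV3 hPV
    (by norm_num : (1 / (2 + (1 / 2 : ℝ)) : ℝ) = 2 / 5) hLEI hPR hδ hδ1 hCup hup hc₀ hδ' hlow

/-- **The power-spread stratum of rung C1 at the endpoint, in the shape of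
`Sig.rungC1_selfSimilar`:** every exactly self-similar member of E's class at `ρ = 1/2` whose
pressure profile is the Riesz pressure at large scales and whose profile has the power spread
`c₀|y|^{−(4−δ')} ≤ ‖V(y)‖ ≤ C_up|y|^{1−δ}` far out, vanishes a.e. on the slab (vacuously: there
is no such member, `selfSimilar_half_false_of_powerSpread`). [cite: ChaeShvydkoy2013, §3.1 Thm. 3.1] -/
theorem selfSimilar_half_ae_eq_zero_of_powerSpread
    {u : ℝ → EuclideanSpace ℝ (Fin 3) → EuclideanSpace ℝ (Fin 3)}
    {p : ℝ → EuclideanSpace ℝ (Fin 3) → ℝ}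
    {H : ℝ → EuclideanSpace ℝ (Fin 3) → EuclideanSpace ℝ (Fin 3) →L[ℝ] EuclideanSpace ℝ (Fin 3)}
    {c : ℝ≥0} {V : EuclideanSpace ℝ (Fin 3) → EuclideanSpace ℝ (Fin 3)}
    {P : EuclideanSpace ℝ (Fin 3) → ℝ}
    (hsw : IsSuitableWeakSolutionOn (slab (EuclideanSpace ℝ (Fin 3)) (Iio 0) isOpen_Iio) 0 0 u p)
    (hH : HasWeakSpatialGradientOn (slab (EuclideanSpace ℝ (Fin 3)) (Iio 0) isOpen_Iio) u H)
    (hgauge : ∀ a : ℝ, 0 < a →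
      ENNReal.ofReal (a ^ (2 * (1 / 2 : ℝ))) * cknA a (0 : ℝ × EuclideanSpace ℝ (Fin 3)) u +
          ENNReal.ofReal (a ^ (1 / 2 : ℝ)) * cknE a (0 : ℝ × EuclideanSpace ℝ (Fin 3)) H +
        ENNReal.ofReal (a ^ (2 * (1 / 2 : ℝ))) * cknD a (0 : ℝ × EuclideanSpace ℝ (Fin 3)) p ≤
          (c : ℝ≥0∞))
    (hu : ∀ τ : ℝ, τ < 0 → u τ = selfSimilarCollapse (1 / (2 + (1 / 2 : ℝ))) 0 V τ)
    (hp : ∀ τ : ℝ, τ < 0 → p τ = selfSimilarCollapsePressure (1 / (2 + (1 / 2 : ℝ))) 0 P τ)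
    {R₁ : ℝ}
    (hPR : ∀ R : ℝ, R₁ ≤ R → ∀ᵐ y ∂volume, ‖y‖ < R / 2 →
      P y = rieszPressure ((ball (0 : EuclideanSpace ℝ (Fin 3)) R).indicator V) y +
        ∫ z in {z | R ≤ ‖z‖}, pressureKernel (y - z) (V z))
    {δ Cup R₀ : ℝ} (hδ : 0 < δ) (hδ1 : δ ≤ 1) (hCup : 0 ≤ Cup)
    (hup : ∀ᵐ y ∂volume, R₀ ≤ ‖y‖ → ‖V y‖ ≤ Cup * ‖y‖ ^ (1 - δ))
    {c₀ δ' R₀' : ℝ} (hc₀ : 0 < c₀) (hδ' : 0 < δ')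
    (hlow : ∀ᵐ y ∂volume, R₀' ≤ ‖y‖ → c₀ * ‖y‖ ^ (-(4 - δ')) ≤ ‖V y‖) :
    uncurry u =ᵐ[volume.restrict (Iio (0 : ℝ) ×ˢ (univ : Set (EuclideanSpace ℝ (Fin 3))))] 0 :=
  (selfSimilar_half_false_of_powerSpread hsw hH hgauge hu hp hPR hδ hδ1 hCup hup hc₀ hδ' hlow).elim

end Member

end Summit.NavierStokesRegularity.NavierStokesRegularity.Theorems.PowerGaugeEulerLiouville
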